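import Summits.MatrixMultiplication.OmegaCensus.TriangleTorusLadder
import Mathlib.Algebra.BigOperators.Intervals
import Mathlib.Algebra.BigOperators.Ring.Finset
import Mathlib.Algebra.Order.BigOperators.Group.Finset

/-!
# Triangle factors of the punctured torus: the imbalance bound `3·|#up − #down| ≤ 4n + 2` (kernel)

ω-census `pub-omega`, family (b3), seat pub-omega-group gen 33.  Framing: lottery ticket; floor = certified bounds/negative
ranges.  VALUE: KERNEL proof of the cell's Theorem B (RESULTS-g32, HOME/pub-omega-group-g32/; there at paper grade with the
planar van Kampen lemma cited): **in every partition of `ℤ_n² ∖ {0}` (`3 ∤ n`) into translates of the triangles `{0,e₁,e₂}`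
and `{0,−e₁,−e₂}`, `3·|#up − #down| ≤ 4n + 2`** (`TriangleFactor.three_mul_abs_sub_le`).  NOT progress on ω; the corollary
"no part of size 3 in a cube symmetric form over `ℤ_p²`, all primes `p`" is drawn in `ThreeSetNoPartThree.lean`.

Proof (the ladder route of RESULTS-g32 §6(i), entirely finite/algebraic — no plane topology):
* `Qz c` := the three-period functional `Q` (file `TriangleTorusHolonomy`) of one period (`2n` slots) of the detoured zigzag
  `Ẑ_c`; by the window lemma it can be read off ANY `2n` consecutive slots (`Q_OutL`, `Q_InL`), and `Qz (c + n) = Qz c`.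
* Hole-free column `c`: the ladder lemma over one period, the rung identity `sV c (lo+n−1) = ρ^t sV c (lo−1)` and `Q_conj`,
  `Q_mul_cen` give `Qz c = Qz (c−1) + 3·colCharge c` (`Qz_step`), `colCharge c = 18·(#up − #down anchored in column c)`.
* Hole column: the same with the hexagon loop inserted (`ladder_hole_run`, `Q_mul_left`) gives a defect of absolute value
  `≤ 36 + 18·(#steps of the period) ≤ 36 + 72n` (`Qz_step_hole`; every in-piece has ≤ 4 steps, every step is in the star,
  `defect_const_bound`, `defect_step_bound`).
* Telescoping over the `n` columns: `54·|#up − #down| ≤ 36 + 72n`.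
-/

namespace Summit.MatrixMultiplication.OmegaCensus.TriangleTorus

open Finset

/-! ## Small additions to the algebraic layer -/

/-- Membership in a window. [folklore] -/
theorem mem_lconcat {f : ℤ → List (ℤ × ℤ)} {a : ℤ} {m : ℕ} {s : ℤ × ℤ} (h : s ∈ lconcat f a m) :
    ∃ i : ℕ, i < m ∧ s ∈ f (a + i) := by
  induction m with
  | zero => simp at h
  | succ m ih =>
    rw [lconcat_succ, List.mem_append] at h
    rcases h with h | h
    · obtain ⟨i, hi, hs⟩ := ih h
      exact ⟨i, Nat.lt_succ_of_lt hi, hs⟩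
    · exact ⟨m, Nat.lt_succ_self m, h⟩

/-- The linear part of the hole defect (`Q_mul_left`). [folklore] -/
def dfun (t : ZMod 3) (c v : ℤ × ℤ) : ℤ := 3 * det₂ c v + det₂ c (rot t v) + det₂ v (rot t c)

/-- [folklore] -/
theorem dfun_zero (t : ZMod 3) (c : ℤ × ℤ) : dfun t c 0 = 0 := by
  simp [dfun, det₂]

/-- [folklore] -/
theorem dfun_add (t : ZMod 3) (c v w : ℤ × ℤ) : dfun t c (v + w) = dfun t c v + dfun t c w := by
  simp only [dfun, rot_add_vec, det₂, Prod.fst_add, Prod.snd_add]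
  ring

/-- A linear functional bounded by `B` on every step is bounded by `B · length` on the sum. [folklore] -/
theorem abs_dfun_sum_le (t : ZMod 3) (c : ℤ × ℤ) (B : ℤ) (L : List (ℤ × ℤ)) (hL : ∀ s ∈ L, |dfun t c s| ≤ B) :
    |dfun t c L.sum| ≤ B * L.length := by
  induction L with
  | nil => simp [dfun_zero]
  | cons s L ih =>
    rw [List.sum_cons, dfun_add, List.length_cons, Nat.cast_succ, mul_add, mul_one, add_comm (B * _)]
    exact (abs_add_le _ _).trans
      (add_le_add (hL s List.mem_cons_self) (ih fun s' hs' => hL s' (List.mem_cons_of_mem s hs')))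

namespace TriangleFactor

variable {n : ℕ} (T : TriangleFactor n)

/-! ## Facts about the pieces used by the torus bookkeeping -/

/-- Every in-piece has at most four steps. [folklore] -/
theorem length_inPiece_le (c j : ℤ) : (T.inPiece c j).length ≤ 4 := by
  unfold inPiece fin0 fin1
  split_ifs <;> simp

/-- Every step of an in-piece lies in the six-element star. [folklore] -/
theorem mem_steps6_of_mem_inPiece (c j : ℤ) : ∀ s ∈ T.inPiece c j, s ∈ steps6 := by
  have H : ∀ c j, sH c j ∈ steps6 ∧ -sH c j ∈ steps6 ∧ sV c j ∈ steps6 ∧ -sV c j ∈ steps6 ∧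
      sD c j ∈ steps6 ∧ -sD c j ∈ steps6 := fun c j =>
    ⟨(sH_mem_steps6 c j).1, (sH_mem_steps6 c j).2, (sV_mem_steps6 c j).1, (sV_mem_steps6 c j).2,
      (sD_mem_steps6 c j).1, (sD_mem_steps6 c j).2⟩
  unfold inPiece fin0 fin1
  split_ifs <;> simp [H]

/-- Height periodicity of the even slots (tiles are `n`-periodic, steps rotate by `ρ^{−n}`). [folklore] -/
theorem f0_add_right (c j : ℤ) : T.f0 c (j + n) = (T.f0 c j).map (rot ((-(n : ℤ) : ℤ) : ZMod 3)) := by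
  simp only [f0, T.up_add_right, T.dn_add_right, show j + n - 1 = (j - 1) + n by ring, sV_add_right, sD_add_right,
    sH_add_right]
  split_ifs <;> simp [rot_neg_vec]

/-- Height periodicity of the odd slots. [folklore] -/
theorem f1_add_right (c j : ℤ) : T.f1 c (j + n) = (T.f1 c j).map (rot ((-(n : ℤ) : ℤ) : ZMod 3)) := by
  simp only [f1, T.up_add_right, show j + n + 1 = (j + 1) + n by ring, T.dn_add_right, sV_add_right, sD_add_right,
    sH_add_right]
  split_ifs <;> simp [rot_neg_vec]

/-- Column periodicity of the even slots (steps rotate by `ρ^{n}`). [folklore] -/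
theorem f0_add_left (c j : ℤ) : T.f0 (c + n) j = (T.f0 c j).map (rot ((n : ℤ) : ZMod 3)) := by
  simp only [f0, T.up_add_left, show c + n + 1 = (c + 1) + n by ring, show c + n - 1 = (c - 1) + n by ring,
    T.dn_add_left, sV_add_left, sD_add_left, sH_add_left]
  split_ifs <;> simp [rot_neg_vec]

/-- Column periodicity of the odd slots. [folklore] -/
theorem f1_add_left (c j : ℤ) : T.f1 (c + n) j = (T.f1 c j).map (rot ((n : ℤ) : ZMod 3)) := by
  simp only [f1, T.up_add_left, show c + n + 1 = (c + 1) + n by ring, show c + n - 1 = (c - 1) + n by ring,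
    T.dn_add_left, sV_add_left, sD_add_left, sH_add_left]
  split_ifs <;> simp [rot_neg_vec]

/-- The slot sequence of `Ẑ_c` is `2n`-periodic up to the rotation `ρ^{−n}`. [folklore] -/
theorem slot_add_period (c k : ℤ) : T.slot c (k + 2 * n) = (T.slot c k).map (rot ((-(n : ℤ) : ℤ) : ZMod 3)) := by
  unfold slot
  have h1 : (k + 2 * n) % 2 = k % 2 := by omega
  have h2 : (k + 2 * n) / 2 = k / 2 + n := by omega
  rw [h1, h2]
  split_ifs
  · exact T.f0_add_right c (k / 2)
  · exact T.f1_add_right c (k / 2)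

/-- The slot sequence of `Ẑ_{c+n}` is that of `Ẑ_c` rotated by `ρ^{n}`. [folklore] -/
theorem slot_add_left (c k : ℤ) : T.slot (c + n) k = (T.slot c k).map (rot ((n : ℤ) : ZMod 3)) := by
  unfold slot
  split_ifs
  · exact T.f0_add_left c (k / 2)
  · exact T.f1_add_left c (k / 2)

/-- The charge is `n`-periodic in the height. [folklore] -/
theorem charge_add_right (c j : ℤ) : T.charge c (j + n) = T.charge c j := by
  simp only [charge, T.up_add_right, T.dn_add_right]

/-- A window of `n` consecutive charges does not depend on its start (one step). [folklore] -/
theorem kc_shift (c lo : ℤ) : T.kc c (lo + 1) n = T.kc c lo n := by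
  have h := T.kc_succ' c lo n
  rw [show T.kc c lo (n + 1) = T.kc c lo n + T.charge c (lo + (n : ℕ)) from rfl] at h
  have : T.charge c (lo + (n : ℕ)) = T.charge c lo := by exact_mod_cast T.charge_add_right c lo
  linarith

/-- Block boundaries are `n`-periodic. [folklore] -/
theorem bdry_add_right (c k : ℤ) : T.bdry c (k + n) ↔ T.bdry c k := by
  simp only [bdry, show k + n - 1 = (k - 1) + n by ring, T.up_add_right, T.dn_add_right]

/-- Every column has a block boundary below cell `0` or below cell `1`. [folklore] -/
theorem bdry_zero_or_one (c : ℤ) : T.bdry c 0 ∨ T.bdry c 1 := by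
  obtain ⟨-, -, -, h3, h4, -, -, -⟩ := six_cases (T.cover c 0)
  by_cases hu : T.up c (0 - 1) = true
  · obtain ⟨h0, -, -, -, h5⟩ := h3 hu
    exact Or.inr ⟨by simpa using h0, by simpa using h5⟩
  by_cases hd : T.dn c 0 = true
  · obtain ⟨h0, -, -, -, h5⟩ := h4 hd
    exact Or.inr ⟨by simpa using h0, by simpa using h5⟩
  exact Or.inl ⟨by simpa using hu, by simpa using hd⟩

/-- The period rotation index: heights `j` and `j + n` differ by the rotation `ρ^{−n}`. [folklore] -/
def trot (n : ℕ) : ZMod 3 := ((-(n : ℤ) : ℤ) : ZMod 3)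

/-- `ρ^{−n} ≠ 1` iff `3 ∤ n`. [folklore] -/
theorem trot_ne_zero (h3 : ¬ 3 ∣ n) : trot n ≠ 0 := by
  intro h
  rw [trot, ZMod.intCast_zmod_eq_zero_iff_dvd, Int.dvd_neg] at h
  exact h3 (by exact_mod_cast h)

/-- The invariant of the strip between columns `c` and `c+1`: the three-period functional of one period of `Ẑ_c`.
[folklore] -/
def Qz (c : ℤ) : ℤ := Q (trot n) (hol (lconcat (T.slot c) 0 (2 * n)))

/-- [folklore] -/
theorem OutL_eq_slots (c lo : ℤ) (m : ℕ) : T.OutL c lo m = lconcat (T.slot c) (2 * lo + (-1)) (2 * m) :=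
  lconcat_pairs (T.slot c) (T.outPiece c) (-1) (fun j => T.outPiece_eq_slots c j) lo m

/-- [folklore] -/
theorem InL_eq_slots (c lo : ℤ) (m : ℕ) : T.InL c lo m = lconcat (T.slot (c - 1)) (2 * lo + 0) (2 * m) :=
  lconcat_pairs (T.slot (c - 1)) (T.inPiece c) 0 (fun j => T.inPiece_eq_slots c j) lo m

/-- [folklore] -/
theorem slot_add_period' (c k : ℤ) : T.slot c (k + ((2 * n : ℕ) : ℤ)) = (T.slot c k).map (rot (trot n)) := by
  rw [trot, ← T.slot_add_period c k]; push_cast; ring_nf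

/-- The OUT-run of any period of column `c` computes `Qz c`. [folklore] -/
theorem Q_OutL (h3 : ¬ 3 ∣ n) (c lo : ℤ) : Q (trot n) (hol (T.OutL c lo n)) = T.Qz c := by
  rw [OutL_eq_slots, Qz]
  exact Q_window _ (trot_ne_zero h3) _ (2 * n) (T.slot_add_period' c) _ _

/-- The IN-run of any period of column `c` computes `Qz (c − 1)`. [folklore] -/
theorem Q_InL (h3 : ¬ 3 ∣ n) (c lo : ℤ) : Q (trot n) (hol (T.InL c lo n)) = T.Qz (c - 1) := by
  rw [InL_eq_slots, Qz]
  exact Q_window _ (trot_ne_zero h3) _ (2 * n) (T.slot_add_period' (c - 1)) _ _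

/-- `Qz` is `n`-periodic in the column. [folklore] -/
theorem Qz_add_left (c : ℤ) : T.Qz (c + n) = T.Qz c := by
  unfold Qz
  rw [show lconcat (T.slot (c + n)) 0 (2 * n) = (lconcat (T.slot c) 0 (2 * n)).map (rot ((n : ℤ) : ZMod 3)) by
    rw [lconcat_map]; exact lconcat_congr fun i _ => T.slot_add_left c (0 + i), hol_map_rot, Q_rotH]

/-- The charge of one period of column `c`: `18·(#up-tiles − #down-tiles anchored in the column)`. [folklore] -/
def colCharge (c : ℤ) : ℤ := T.kc c 0 n

/-- [folklore] -/
theorem kc_base {c lo : ℤ} (hlo : lo = 0 ∨ lo = 1) : T.kc c lo n = T.colCharge c := by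
  rcases hlo with rfl | rfl
  · rfl
  · rw [colCharge, ← T.kc_shift c 0, zero_add]

/-- A base boundary in `{0, 1}` for every column. [folklore] -/
theorem exists_base (c : ℤ) : ∃ lo : ℤ, (lo = 0 ∨ lo = 1) ∧ T.bdry c lo := by
  rcases T.bdry_zero_or_one c with h | h
  · exact ⟨0, Or.inl rfl, h⟩
  · exact ⟨1, Or.inr rfl, h⟩

/-- The top rung of a period is the bottom rung rotated by `ρ^{−n}`. [folklore] -/
theorem rung_period (c lo : ℤ) : sV c (lo + n - 1) = rot (trot n) (sV c (lo - 1)) := by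
  rw [show lo + (n : ℤ) - 1 = (lo - 1) + n by ring, sV_add_right]; rfl

/-- **Hole-free column step.** `Qz c = Qz (c−1) + 3·colCharge c`. [folklore] -/
theorem Qz_step (h3 : ¬ 3 ∣ n) (c : ℤ) (hc : ¬ (n : ℤ) ∣ c) : T.Qz c = T.Qz (c - 1) + 3 * T.colCharge c := by
  obtain ⟨lo, hlo, hb⟩ := T.exists_base c
  have hb' : T.bdry c (lo + n) := (T.bdry_add_right c lo).2 hb
  have L := T.ladder c n lo hb hb' (fun i _ h => hc h.1)
  rw [rung_period] at L
  have L' := eq_mul_inv_of_mul_eq L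
  rw [← T.Q_OutL h3 c lo, ← T.Q_InL h3 c lo, ← T.kc_base hlo, L',
    mul_assoc (st (sV c (lo - 1))) (hol (T.InL c lo n)) (cen _), Q_conj _ (trot_ne_zero h3), Q_mul_cen]

/-- **Hole column step.** `|Qz c − Qz (c−1) − 3·colCharge c| ≤ 36 + 72n`. [folklore] -/
theorem Qz_step_hole (h3 : ¬ 3 ∣ n) (hn : 1 ≤ n) (c : ℤ) (hc : (n : ℤ) ∣ c) :
    |T.Qz c - T.Qz (c - 1) - 3 * T.colCharge c| ≤ 36 + 72 * n := by
  obtain ⟨m, hm⟩ : ∃ m : ℕ, n = m + 1 := ⟨n - 1, by omega⟩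
  have hh : hole n c 0 := ⟨hc, dvd_zero _⟩
  have hb0 : T.bdry c 0 := by
    obtain ⟨hP, -, -, -, -, -, -, -⟩ := six_cases (T.cover c 0)
    obtain ⟨-, -, hut, hdt, -, -⟩ := hP.1 hh
    exact ⟨hut, hdt⟩
  have hb' : T.bdry c (0 + 1 + m) := by
    rw [show (0 : ℤ) + 1 + m = 0 + n by rw [hm]; push_cast; ring]; exact (T.bdry_add_right c 0).2 hb0
  have L := T.ladder_hole_run c 0 m hh hb' (fun i hi h => by
    obtain ⟨k, hk⟩ := h.2
    rcases le_or_gt k 0 with hk0 | hk0 <;> nlinarith)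
  rw [show (0 : ℤ) + m = 0 + n - 1 by rw [hm]; push_cast; ring, rung_period, ← hm,
    mul_assoc (st (sV c (0 - 1))) (hol (hexLoop c 0)) (hol (T.InL c 0 n)),
    mul_assoc (st (sV c (0 - 1))) (hol (hexLoop c 0) * hol (T.InL c 0 n)) (cen _),
    mul_assoc (hol (hexLoop c 0)) (hol (T.InL c 0 n)) (cen _)] at L
  have L' := eq_mul_inv_of_mul_eq L
  have key : T.Qz c = Q (trot n) (hol (hexLoop c 0) * (hol (T.InL c 0 n) * cen (T.kc c 0 n))) := by
    rw [← T.Q_OutL h3 c 0, L', Q_conj _ (trot_ne_zero h3)]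
  rw [key, ← mul_assoc, Q_mul_cen, Q_mul_left, T.Q_InL h3 c 0]
  have hC := defect_const_bound c 0 (trot n)
  have hlen : ((T.InL c 0 n).length : ℤ) ≤ 4 * n := by
    have := length_lconcat_le (T.inPiece c) 0 n 4 (T.length_inPiece_le c)
    rw [InL]; linarith [this]
  have hLin : |dfun (trot n) (hol (hexLoop c 0)).v (hol (T.InL c 0 n)).v| ≤ 18 * (T.InL c 0 n).length := by
    rw [hol_v_eq_sum (T.InL c 0 n)]
    refine abs_dfun_sum_le _ _ 18 _ fun s hs => ?_
    obtain ⟨i, -, hi⟩ := mem_lconcat hs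
    exact defect_step_bound c 0 (trot n) s (T.mem_steps6_of_mem_inPiece c (0 + i) s hi)
  rw [show T.kc c 0 n = T.colCharge c from rfl]
  have e : ∀ X C D K : ℤ, X + C + D + 3 * K - X - 3 * K = C + D := fun _ _ _ _ => by ring
  rw [e]
  refine (abs_add_le _ _).trans ?_
  have : |dfun (trot n) (hol (hexLoop c 0)).v (hol (T.InL c 0 n)).v| ≤ 72 * n := hLin.trans (by nlinarith)
  unfold dfun at this
  linarith

/-! ## Counting and telescoping -/

/-- [folklore] -/
theorem kc_eq_sum (c lo : ℤ) (m : ℕ) : T.kc c lo m = ∑ i ∈ range m, T.charge c (lo + i) := by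
  induction m with
  | zero => simp [kc]
  | succ m ih => rw [sum_range_succ, ← ih]; rfl

/-- Number of up-tiles (anchors in the fundamental domain `[0,n)²`). [folklore] -/
def upCount : ℤ := ∑ c ∈ range n, ∑ j ∈ range n, if T.up c j then 1 else 0

/-- Number of down-tiles (anchors in the fundamental domain `[0,n)²`). [folklore] -/
def dnCount : ℤ := ∑ c ∈ range n, ∑ j ∈ range n, if T.dn c j then 1 else 0

/-- The total charge is `18·(#up − #down)`. [folklore] -/
theorem sum_colCharge : ∑ c ∈ range n, T.colCharge c = 18 * T.upCount - 18 * T.dnCount := by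
  rw [upCount, dnCount, Finset.mul_sum, Finset.mul_sum, ← Finset.sum_sub_distrib]
  refine Finset.sum_congr rfl fun c _ => ?_
  rw [colCharge, kc_eq_sum, Finset.mul_sum, Finset.mul_sum, ← Finset.sum_sub_distrib]
  refine Finset.sum_congr rfl fun j _ => ?_
  rw [zero_add, charge]
  split_ifs <;> simp

/-- **Theorem B (RESULTS-g32), kernel.**  In every triangle factor of the punctured discrete torus `ℤ_n² ∖ {0}` with
`3 ∤ n`: `3·|#up − #down| ≤ 4n + 2`. [folklore] -/
theorem three_mul_abs_sub_le (h3 : ¬ 3 ∣ n) (hn : 1 ≤ n) : 3 * |T.upCount - T.dnCount| ≤ 4 * n + 2 := by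
  -- telescoping
  have tel : ∑ i ∈ range n, (T.Qz ((i + 1 : ℕ) - 1 : ℤ) - T.Qz ((i : ℕ) - 1 : ℤ)) = 0 := by
    rw [Finset.sum_range_sub (fun i : ℕ => T.Qz ((i : ℤ) - 1)) n]
    have := T.Qz_add_left (-1)
    rw [show (-1 : ℤ) + n = (n : ℤ) - 1 by ring] at this
    push_cast; linarith
  -- per column
  set D : ℤ := T.Qz 0 - T.Qz (0 - 1) - 3 * T.colCharge 0 with hD
  have hDle : |D| ≤ 36 + 72 * n := T.Qz_step_hole h3 hn 0 (dvd_zero _)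
  have per : ∀ i ∈ range n, (T.Qz ((i + 1 : ℕ) - 1 : ℤ) - T.Qz ((i : ℕ) - 1 : ℤ)) =
      3 * T.colCharge i + (if i = 0 then D else 0) := by
    intro i hi
    rw [mem_range] at hi
    rcases Nat.eq_zero_or_pos i with rfl | hpos
    · simp [hD]
    · rw [if_neg hpos.ne']
      have hndvd : ¬ (n : ℤ) ∣ (i : ℤ) := by
        intro h; have := Int.le_of_dvd (by exact_mod_cast hpos) h; omega
      have := T.Qz_step h3 i hndvd
      rw [show (((i + 1 : ℕ) : ℤ) - 1) = i by push_cast; ring, add_zero, this]; ring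
  have hδ : ∑ i ∈ range n, (if i = 0 then D else 0) = D := by
    rw [Finset.sum_eq_single 0 (fun b _ hb => if_neg hb) (fun h => absurd (mem_range.2 (by omega)) h), if_pos rfl]
  rw [Finset.sum_congr rfl per, Finset.sum_add_distrib, ← Finset.mul_sum, hδ, sum_colCharge] at tel
  -- |3·18·(U − D)| = |D| ≤ 36 + 72 n
  have habs : 54 * |T.upCount - T.dnCount| ≤ 36 + 72 * n := by
    rw [show (54 : ℤ) = |(54 : ℤ)| from (abs_of_nonneg (by norm_num)).symm, ← abs_mul]
    have : 54 * (T.upCount - T.dnCount) = -D := by linarith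
    rw [this, abs_neg]; exact hDle
  linarith

end TriangleFactor

end Summit.MatrixMultiplication.OmegaCensus.TriangleTorus
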